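import Summits.Ventures.PercRepro.RankLevelSetExplicitLin2CoreMult
import Summits.Ventures.PercRepro.RankLevelSetExplicitLin2CoreMultTail
import Summits.Ventures.PercRepro.RankLevelSetExplicitLin2KeyG
import Summits.Ventures.PercRepro.RankLevelSetExplicitLin2KeyQuart
import Summits.Ventures.PercRepro.RankLevelSetExplicitLin2LargeSharp
import Summits.Ventures.PercRepro.RankLevelSetDepCountMultQuart
import Summits.Ventures.PercRepro.RankLevelSetDepCountMultIndep
import Summits.Ventures.PercRepro.S2MultWeightSumsC

/-!
# PercRepro — THE THEOREM-M KEY OF `(P_d)`: THE STAIRCASE MULTIPLICITY, ITS CERTIFICATE, THE CORE CELL AND THE LEVEL (p4, S4 feed)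

`proofs/P4-gen18.md`. THEOREM M (S2IndepMultiplicity / S2IndepCount): every rank-`q` set of `m` elements of the `e`-free core
contains `≥ L_{j₀}(m − q) = j₀·(C(m − q, j₀) − (2^{j₀−1} − j₀)·C(m − q, j₀ − 1))` pairs for EVERY `j₀`
(`Matroid.ncard_eRk_eq_ncard_eq_mul_le_indep`, RankLevelSetDepCountMultIndep), and `≥ quart(m − q)` (RankLevelSetDepCountMultQuart).
The STAIRCASE `multStair(ν) = max(quart(ν), max_{3 ≤ j₀ ≤ 12} L_{j₀}(ν))` is therefore a multiplicity in the sense of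
`c025_core_lin2_of_poly_mult` (RankLevelSetExplicitLin2CoreMult). Its class weight `W(μ) = Σ_j C(μ − 1, j)/multStair(j + 1)`
is certified per class in the integer form `W·D ≤ c·2^μ` of the generic key `KeyG` (S2MultWeightSumsC): the split
`J = max(3μ/8, 6)`, the order `j₀ = j0Of J` (the largest `3 ≤ j ≤ 12` with `j + c₀(j)·j ≤ J`, `c₀(j) = 2^{j−1} − j`), the ratio
`a/b = (J + 2 − j₀)/(J + 2 − j₀ − c₀·j₀)`, the head through the quartic and the Chernoff trick `(5, 3)`, the tail through
`L_{j₀}`; `D = C(μ + 3, 4)·X·P`, `c = 2^{2μ+9}·X + a·C(J + j₀, j₀)·2^{j₀−1}·C(μ + 3, 4)·P` with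
`X = b·j₀·C(μ − 1 + j₀, j₀)·C(J + 1, j₀)`, `P = 5^{μ−J}·3^{J+3}` (`certC`, `certD`). `KeyL q p d` is `KeyG` with these
certificates; `c025_core_lin2_of_keyL` closes the `e`-free core cell from it and `c025_level_succ_of_keyL_row` /
`c025_level_succ_of_keyL_row'` give the level from one evaluated row (RankLevelSetExplicitLin2KeyG / …LargeSharp).
The rows (kernel `decide` at the Chernoff-tail floors `1 212 / 2 367 / 4 674 / …` of RankLevelSetExplicitLin2LevelTail, against the
quartic `2 126 / 4 309 / 8 764 / …`) are the modules RankLevelSetExplicitLin2IndepRowTen, … . Axioms: standard.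
-/

open scoped Matroid

namespace PercRepro

namespace ThmN

namespace Explicit

/-- `c₀(j) = 2^{j−1} − j`, the correction of THEOREM M's count. -/
abbrev cZero (j : ℕ) : ℕ := 2 ^ (j - 1) - j

/-- THEOREM M's multiplicity bound `L_{j₀}(ν) = j₀·(C(ν, j₀) − (2^{j₀−1} − j₀)·C(ν, j₀ − 1))` (`S2.card_spanF_ge_indep`). -/
abbrev Lbound (j₀ ν : ℕ) : ℕ := j₀ * (ν.choose j₀ - (2 ^ (j₀ - 1) - j₀) * ν.choose (j₀ - 1))

/-- **THE STAIRCASE MULTIPLICITY** `max(quart(ν), max_{3 ≤ j₀ ≤ 12} L_{j₀}(ν))`. -/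
abbrev multStair (v : ℕ) : ℕ := max (quartMult v) ((Finset.Icc 3 12).sup (fun j => Lbound j v))

/-- The split of the certificate at class size `μ`: `J = max(3μ/8, 6)`. -/
abbrev certJ (μ : ℕ) : ℕ := max (3 * μ / 8) 6

/-- The order of the certificate at split `J`: the largest `3 ≤ j ≤ 12` with `j + c₀(j)·j ≤ J`
(thresholds `20, 60, 162, 406, 968, 2232, 5030, 11154, 24444`). -/
def j0Of (J : ℕ) : ℕ :=
  if 24444 ≤ J then 12 else if 11154 ≤ J then 11 else if 5030 ≤ J then 10 else if 2232 ≤ J then 9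
  else if 968 ≤ J then 8 else if 406 ≤ J then 7 else if 162 ≤ J then 6 else if 60 ≤ J then 5
  else if 20 ≤ J then 4 else 3

/-- The ratio numerator `a = J + 2 − j₀`. -/
abbrev certA (μ : ℕ) : ℕ := certJ μ + 2 - j0Of (certJ μ)

/-- The ratio denominator `b = a − c₀(j₀)·j₀`. -/
abbrev certB (μ : ℕ) : ℕ := certA μ - cZero (j0Of (certJ μ)) * j0Of (certJ μ)

/-- `X = b·j₀·C(μ − 1 + j₀, j₀)·C(J + 1, j₀)`. -/
abbrev certX (μ : ℕ) : ℕ :=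
  certB μ * j0Of (certJ μ) * chooseD (μ - 1 + j0Of (certJ μ)) (j0Of (certJ μ)) *
    chooseD (certJ μ + 1) (j0Of (certJ μ))

/-- `P = 5^{μ−J}·3^{J+3}`, the Chernoff denominator of the head. -/
abbrev certP (μ : ℕ) : ℕ := 5 ^ (μ - certJ μ) * 3 ^ (certJ μ + 3)

/-- The certificate denominator `D = C(μ + 3, 4)·X·P`. -/
abbrev certD (μ : ℕ) : ℕ := chooseD (μ + 3) 4 * certX μ * certP μ

/-- The certificate numerator `c = 2^{2μ+9}·X + a·C(J + j₀, j₀)·2^{j₀−1}·C(μ + 3, 4)·P`. -/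
abbrev certC (μ : ℕ) : ℕ :=
  2 ^ (2 * μ + 9) * certX μ +
    certA μ * chooseD (certJ μ + j0Of (certJ μ)) (j0Of (certJ μ)) * 2 ^ (j0Of (certJ μ) - 1) *
      chooseD (μ + 3) 4 * certP μ

/-- **THE THEOREM-M KEY**: `KeyG` with the staircase certificates `W·certD ≤ certC·2^μ` in both classes. -/
abbrev KeyL (q p d : ℕ) : Prop :=
  KeyG q p d (certC (min (5 * 2 ^ (q - 4) - q) d)) (certD (min (5 * 2 ^ (q - 4) - q) d))
    (certC (min (5 * 2 ^ (q - 3) - q - 1) d)) (certD (min (5 * 2 ^ (q - 3) - q - 1) d))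

/-- `KeyL` is monotone in the rank (`q ≤ d`). -/
theorem keyL_succ (q p d : ℕ) (hd : q ≤ d) (h : KeyL q p d) : KeyL q (p + 1) d :=
  keyG_succ q p d _ _ _ _ hd h

/-- `KeyL` at `p₀` gives `KeyL` at every `p ≥ p₀` (`q ≤ d`). -/
theorem keyL_mono (q d p₀ p : ℕ) (hd : q ≤ d) (hp : p₀ ≤ p) (h : KeyL q p₀ d) : KeyL q p d :=
  keyG_mono q d _ _ _ _ p₀ p hd hp h

/-- `3 ≤ j0Of J ≤ 12`. -/
theorem j0Of_bounds (J : ℕ) : 3 ≤ j0Of J ∧ j0Of J ≤ 12 := by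
  unfold j0Of
  split_ifs <;> omega

/-- `j₀ + c₀(j₀)·j₀ ≤ J` for `j₀ = j0Of J` and `6 ≤ J`. -/
theorem j0Of_spec (J : ℕ) (hJ : 6 ≤ J) : j0Of J + cZero (j0Of J) * j0Of J ≤ J := by
  unfold j0Of cZero
  split_ifs <;> norm_num <;> omega

/-- `certJ μ ≤ μ` for `6 ≤ μ`, and `6 ≤ certJ μ`. -/
theorem certJ_bounds (μ : ℕ) (hμ : 6 ≤ μ) : 6 ≤ certJ μ ∧ certJ μ ≤ μ := by
  unfold certJ
  refine ⟨le_max_right _ _, max_le ?_ hμ⟩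
  omega

/-- The ratio condition of the certificate at `ν = J + 1`: `a·(c₀·j₀) + b·(J + 2 − j₀) ≤ a·(J + 2 − j₀)`, `2 ≤ b`. -/
theorem cert_ratio (μ : ℕ) (hμ : 6 ≤ μ) :
    2 ≤ certB μ ∧
      certA μ * (cZero (j0Of (certJ μ)) * j0Of (certJ μ)) + certB μ * (certJ μ + 2 - j0Of (certJ μ)) ≤
        certA μ * (certJ μ + 2 - j0Of (certJ μ)) := by
  obtain ⟨hJ6, -⟩ := certJ_bounds μ hμ
  have hspec := j0Of_spec (certJ μ) hJ6
  obtain ⟨hj3, hj12⟩ := j0Of_bounds (certJ μ)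
  set J := certJ μ with hJ
  set j₀ := j0Of J with hj₀
  set c := cZero j₀ * j₀ with hc
  have ha : certA μ = J + 2 - j₀ := rfl
  have hb : certB μ = (J + 2 - j₀) - c := rfl
  have hca : c ≤ J + 2 - j₀ := by omega
  refine ⟨by rw [hb]; omega, ?_⟩
  rw [ha, hb]
  set A := J + 2 - j₀ with hA
  have key : (A - c) * A = A * A - c * A := Nat.sub_mul A c A
  have h1 : c * A ≤ A * A := Nat.mul_le_mul_right A hca
  have h2 : A * c = c * A := mul_comm A c
  omega

/-- The certificate denominator is positive (`6 ≤ μ`). -/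
theorem certD_pos (μ : ℕ) (hμ : 6 ≤ μ) : 0 < certD μ := by
  obtain ⟨hJ6, hJμ⟩ := certJ_bounds μ hμ
  have hspec := j0Of_spec (certJ μ) hJ6
  obtain ⟨hj3, hj12⟩ := j0Of_bounds (certJ μ)
  obtain ⟨hb2, -⟩ := cert_ratio μ hμ
  unfold certD certX certP
  simp only [chooseD_eq]
  have h1 : 0 < (μ + 3).choose 4 := Nat.choose_pos (by omega)
  have h2 : 0 < (μ - 1 + j0Of (certJ μ)).choose (j0Of (certJ μ)) := Nat.choose_pos (by omega)
  have h3 : 0 < (certJ μ + 1).choose (j0Of (certJ μ)) := Nat.choose_pos (by omega)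
  positivity

/-- **THE STAIRCASE WEIGHT BOUND**: `(Σ_{j < N} C(μ − 1, j)/multStair(j + 1))·certD μ ≤ certC μ·2^μ` for `6 ≤ μ`
(S2MultWeightSumsC: head + tail at the split `certJ μ`, order `j0Of`, ratio `certA/certB`). -/
theorem stair_weight_bound (μ N : ℕ) (hμ : 6 ≤ μ) :
    (∑ j ∈ Finset.range N, (((μ - 1).choose j : ℕ) : ℚ) / ((multStair (j + 1) : ℕ) : ℚ)) * ((certD μ : ℕ) : ℚ) ≤
      ((certC μ : ℕ) : ℚ) * 2 ^ μ := by
  obtain ⟨hJ6, hJμ⟩ := certJ_bounds μ hμ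
  have hspec := j0Of_spec (certJ μ) hJ6
  obtain ⟨hj3, hj12⟩ := j0Of_bounds (certJ μ)
  obtain ⟨hb2, hratio⟩ := cert_ratio μ hμ
  -- the head + tail bound of S2MultWeightSumsC for `mult = multStair`
  have hquart : ∀ v, v + 3 * v.choose 2 + 3 * v.choose 3 + 2 * v.choose 4 ≤ multStair v :=
    fun v => le_max_left _ _
  have hL : ∀ v, Lbound (j0Of (certJ μ)) v ≤ multStair v := fun v =>
    le_trans (Finset.le_sup (f := fun j => Lbound j v) (by rw [Finset.mem_Icc]; omega)) (le_max_right _ _)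
  have hW := S2.sum_range_choose_div_mult_le_head_add_tail multStair hquart (j0Of (certJ μ)) hL (μ - 1) N (certJ μ)
    (certA μ) (certB μ) (by omega) (by omega) (by omega) (by omega) hratio
  -- the certificate: `head·D = 2^{2μ+9}·X·2^μ`, `tail·D = a·C(J + j₀, j₀)·2^{j₀−1}·C(μ + 3, 4)·P·2^μ`
  set J := certJ μ with hJ
  set j₀ := j0Of J with hj₀
  set a := certA μ with ha
  set b := certB μ with hb
  have hF4 : μ - 1 + 4 = μ + 3 := by omega
  have hF1 : μ - 1 + 1 - J = μ - J := by omega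
  rw [hF4, hF1] at hW
  have hD : ((certD μ : ℕ) : ℚ) =
      ((μ + 3).choose 4 : ℚ) * ((b : ℚ) * (j₀ : ℚ) * ((μ - 1 + j₀).choose j₀ : ℚ) * ((J + 1).choose j₀ : ℚ)) *
        ((5 : ℚ) ^ (μ - J) * (3 : ℚ) ^ (J + 3)) := by
    unfold certD certX certP
    simp only [chooseD_eq]
    push_cast
    ring
  have hC : ((certC μ : ℕ) : ℚ) =
      (2 : ℚ) ^ (2 * μ + 9) * ((b : ℚ) * (j₀ : ℚ) * ((μ - 1 + j₀).choose j₀ : ℚ) * ((J + 1).choose j₀ : ℚ)) +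
        (a : ℚ) * ((J + j₀).choose j₀ : ℚ) * (2 : ℚ) ^ (j₀ - 1) * ((μ + 3).choose 4 : ℚ) *
          ((5 : ℚ) ^ (μ - J) * (3 : ℚ) ^ (J + 3)) := by
    unfold certC certX certP
    simp only [chooseD_eq]
    push_cast
    ring
  have hC4 : (0 : ℚ) < ((μ + 3).choose 4 : ℚ) := by exact_mod_cast Nat.choose_pos (by omega : 4 ≤ μ + 3)
  have hCF : (0 : ℚ) < ((μ - 1 + j₀).choose j₀ : ℚ) := by exact_mod_cast Nat.choose_pos (by omega : j₀ ≤ μ - 1 + j₀)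
  have hCJ : (0 : ℚ) < ((J + 1).choose j₀ : ℚ) := by exact_mod_cast Nat.choose_pos (by omega : j₀ ≤ J + 1)
  have hbq : (0 : ℚ) < (b : ℚ) := by exact_mod_cast (by omega : 0 < b)
  have hjq : (0 : ℚ) < (j₀ : ℚ) := by exact_mod_cast (by omega : 0 < j₀)
  have hP : (0 : ℚ) < (5 : ℚ) ^ (μ - J) * (3 : ℚ) ^ (J + 3) := by positivity
  have hDpos : (0 : ℚ) < ((certD μ : ℕ) : ℚ) := by rw [hD]; positivity
  have hpow8 : (8 : ℚ) ^ (μ + 3) = (2 : ℚ) ^ (2 * μ + 9) * 2 ^ μ := by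
    rw [show (8 : ℚ) = 2 ^ 3 by norm_num, ← pow_mul, ← pow_add]; congr 1; ring
  have hpow2 : (2 : ℚ) ^ (μ - 1 + j₀) = (2 : ℚ) ^ (j₀ - 1) * 2 ^ μ := by
    rw [← pow_add]; congr 1; omega
  calc (∑ j ∈ Finset.range N, (((μ - 1).choose j : ℕ) : ℚ) / ((multStair (j + 1) : ℕ) : ℚ)) * ((certD μ : ℕ) : ℚ)
      ≤ ((8 : ℚ) ^ (μ + 3) / ((5 : ℚ) ^ (μ - J) * (3 : ℚ) ^ (J + 3) * ((μ + 3).choose 4 : ℚ)) +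
          ((a : ℚ) / ((b * j₀ : ℕ) : ℚ)) *
            (((((J + j₀).choose j₀ : ℕ) : ℚ) / (((J + 1).choose j₀ : ℕ) : ℚ)) *
              (2 ^ (μ - 1 + j₀) / (((μ - 1 + j₀).choose j₀ : ℕ) : ℚ)))) * ((certD μ : ℕ) : ℚ) :=
        mul_le_mul_of_nonneg_right hW hDpos.le
    _ = ((certC μ : ℕ) : ℚ) * 2 ^ μ := by
        rw [hD, hC, hpow8, hpow2]
        push_cast
        field_simp

end Explicit

variable {α : Type}

/-- **THE CORE CELL FROM ITS THEOREM-M KEY**: the `e`-free core at level `q ≥ 8`, corank `q + 1 ≤ d ≤ q + 2^q`, rank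
`p ≥ 2d + 3q + 5`, satisfies `RLS M p q` once `KeyL q p d` holds (`c025_core_lin2_of_poly_mult` with the staircase level
count — the quartic count and THEOREM M's count for every `3 ≤ j₀ ≤ 12` — and the staircase weight bound through
`poly_of_keyG`). -/
theorem c025_core_lin2_of_keyL (q : ℕ) (hq : 8 ≤ q) (M : Matroid α) [M.Finite] (p d : ℕ)
    (hd1 : q + 1 ≤ d) (hd2 : d ≤ q + 2 ^ q) (htail : 2 * d + 3 * q + 5 ≤ p) (hkey : Explicit.KeyL q p d)
    (hR : M.eRank = (p : ℕ∞)) (hn : M.E.ncard = p + d)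
    (hfree : ∀ e ∈ M.E, ∃ A ⊆ M.E \ {e}, e ∉ M.closure A ∧ e ∉ M.closure ((M.E \ {e}) \ A)) :
    RLS M p q := by
  have hx := Explicit.le_two_pow_sub_four q (by omega)
  obtain ⟨-, -, hq3, h23⟩ := Explicit.two_pow_facts2 q hq
  have hμs6 : 6 ≤ min (5 * 2 ^ (q - 4) - q) d := le_min (by omega) (by omega)
  have hμb6 : 6 ≤ min (5 * 2 ^ (q - 3) - q - 1) d := le_min (by omega) (by omega)
  -- the flat bound `|X| + 1 ≤ 2^{r(X)}` of the `e`-free core, for THEOREM M's count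
  have hL := not_isLoop_of_free M hfree
  have hsp : ∀ k : ℕ, ∀ Y ⊆ M.E, M.eRk Y ≤ k → Y.ncard + 1 ≤ 2 ^ k :=
    fun k Y hY hr => ncard_add_one_le_two_pow_of_eRk_le M hL hfree k Y hY hr
  refine c025_core_lin2_of_poly_mult q hq M p d hd1 hd2 htail Explicit.multStair
    (fun v hv => le_trans (by unfold Explicit.quartMult; omega) (le_max_left _ _))
    (fun f f' hcirc hC1 hC2 hflat hflat' hd m => ?_)
    (fun A B Ws Wb hWs hWb hA hB => ?_) hR hn hfree
  · -- the staircase level count: the quartic count and THEOREM M's count at the attained `j₀`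
    have hquart := Matroid.ncard_eRk_eq_ncard_eq_mul_le_quart M q f f' (by omega) hcirc hC1 hC2 hflat hflat' hd m
    obtain ⟨j, hj, hje⟩ := Finset.exists_mem_eq_sup (Finset.Icc 3 12) ⟨3, by simp⟩
      (fun j => Explicit.Lbound j (m - q))
    rw [Finset.mem_Icc] at hj
    have hindep := Matroid.ncard_eRk_eq_ncard_eq_mul_le_indep M q f f' (by omega) hcirc hsp j (by omega)
      hflat hflat' hd m
    unfold Explicit.multStair
    rw [hje]
    rcases le_total (Explicit.quartMult (m - q)) (Explicit.Lbound j (m - q)) with h | h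
    · rw [max_eq_right h]; exact hindep
    · rw [max_eq_left h]; exact hquart
  · refine Explicit.poly_of_keyG q p d _ _ _ _ (Explicit.certD_pos _ hμs6) (Explicit.certD_pos _ hμb6) hkey A B Ws Wb
      ?_ ?_ hA hB
    · rw [hWs]; exact Explicit.stair_weight_bound _ (d - q) hμs6
    · rw [hWb]; exact Explicit.stair_weight_bound _ (d - q) hμb6

/-- **THE CORE CELL FROM ITS THEOREM-M KEY, WITH THE `(Y)`-TAIL AS A HYPOTHESIS**: as `c025_core_lin2_of_keyL`, with the
binomial-tail inequality `16·Σ_{j ≤ q+d} C(p+d, j) ≤ 2^{p+d}` in place of `2d + 3q + 5 ≤ p` (`c025_core_lin2_of_poly_mult_tail`,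
RankLevelSetExplicitLin2CoreMultTail — the form the Chernoff tail of RankLevelSetExplicitLin2LevelTail plugs into). -/
theorem c025_core_lin2_of_keyL_tail (q : ℕ) (hq : 8 ≤ q) (M : Matroid α) [M.Finite] (p d : ℕ)
    (hd1 : q + 1 ≤ d) (hd2 : d ≤ q + 2 ^ q)
    (hT : 16 * ∑ j ∈ Finset.range (q + d + 1), (p + d).choose j ≤ 2 ^ (p + d)) (hkey : Explicit.KeyL q p d)
    (hR : M.eRank = (p : ℕ∞)) (hn : M.E.ncard = p + d)
    (hfree : ∀ e ∈ M.E, ∃ A ⊆ M.E \ {e}, e ∉ M.closure A ∧ e ∉ M.closure ((M.E \ {e}) \ A)) :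
    RLS M p q := by
  have hx := Explicit.le_two_pow_sub_four q (by omega)
  obtain ⟨-, -, hq3, h23⟩ := Explicit.two_pow_facts2 q hq
  have hμs6 : 6 ≤ min (5 * 2 ^ (q - 4) - q) d := le_min (by omega) (by omega)
  have hμb6 : 6 ≤ min (5 * 2 ^ (q - 3) - q - 1) d := le_min (by omega) (by omega)
  have hL := not_isLoop_of_free M hfree
  have hsp : ∀ k : ℕ, ∀ Y ⊆ M.E, M.eRk Y ≤ k → Y.ncard + 1 ≤ 2 ^ k :=
    fun k Y hY hr => ncard_add_one_le_two_pow_of_eRk_le M hL hfree k Y hY hr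
  refine c025_core_lin2_of_poly_mult_tail q hq M p d hd1 hd2 hT Explicit.multStair
    (fun v hv => le_trans (by unfold Explicit.quartMult; omega) (le_max_left _ _))
    (fun f f' hcirc hC1 hC2 hflat hflat' hd m => ?_)
    (fun A B Ws Wb hWs hWb hA hB => ?_) hR hn hfree
  · have hquart := Matroid.ncard_eRk_eq_ncard_eq_mul_le_quart M q f f' (by omega) hcirc hC1 hC2 hflat hflat' hd m
    obtain ⟨j, hj, hje⟩ := Finset.exists_mem_eq_sup (Finset.Icc 3 12) ⟨3, by simp⟩
      (fun j => Explicit.Lbound j (m - q))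
    rw [Finset.mem_Icc] at hj
    have hindep := Matroid.ncard_eRk_eq_ncard_eq_mul_le_indep M q f f' (by omega) hcirc hsp j (by omega)
      hflat hflat' hd m
    unfold Explicit.multStair
    rw [hje]
    rcases le_total (Explicit.quartMult (m - q)) (Explicit.Lbound j (m - q)) with h | h
    · rw [max_eq_right h]; exact hindep
    · rw [max_eq_left h]; exact hquart
  · refine Explicit.poly_of_keyG q p d _ _ _ _ (Explicit.certD_pos _ hμs6) (Explicit.certD_pos _ hμb6) hkey A B Ws Wb
      ?_ ?_ hA hB
    · rw [hWs]; exact Explicit.stair_weight_bound _ (d - q) hμs6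
    · rw [hWb]; exact Explicit.stair_weight_bound _ (d - q) hμb6

/-- **THE LEVEL FROM ONE EVALUATED THEOREM-M ROW**: level `q + 1 ≥ 8` for every finite matroid and every `p ≥ p₀` from
level `q` for every `p ≥ p₀ − 1`, the key row `KeyL (q + 1) p₀ d` at every core corank `q + 2 ≤ d ≤ q + 1 + 2^{q+1}`,
`p₀ ≥ N₁(q + 1)` and the tail `2(q + 1 + 2^{q+1}) + 3(q + 1) + 5 ≤ p₀` (`c025_level_succ_of_key_row`). -/
theorem c025_level_succ_of_keyL_row (q : ℕ) (hq : 7 ≤ q) (p₀ : ℕ)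
    (hN : 2 ^ (q + 1 + 1) + 2 * (q + 1) ^ 2 + 4 * (q + 1) + 4 ≤ p₀)
    (htail : 2 * (q + 1 + 2 ^ (q + 1)) + 3 * (q + 1) + 5 ≤ p₀)
    (hrow : ∀ t < 2 ^ (q + 1), Explicit.KeyL (q + 1) p₀ (q + 2 + t))
    (hprev : ∀ (M : Matroid α) [M.Finite] (p : ℕ), p₀ - 1 ≤ p → RLS M p q) :
    ∀ (M : Matroid α) [M.Finite] (p : ℕ), p₀ ≤ p → RLS M p (q + 1) :=
  c025_level_succ_of_key_row q hq p₀ (Explicit.KeyL (q + 1)) hN htail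
    (fun p d hd h => Explicit.keyL_succ (q + 1) p d hd h)
    (fun M _ p d hd1 hd2 ht hk hR hn hfree => c025_core_lin2_of_keyL (q + 1) (by omega) M p d hd1 hd2 ht hk hR hn hfree)
    hrow hprev

/-- **THE LEVEL FROM ONE EVALUATED THEOREM-M ROW, WITH THE LARGE-CORANK THEOREM FROM A BASE**: as
`c025_level_succ_of_keyL_row`, but the coranks `> q + 1 + 2^{q+1}` are closed by `c025_core_explicit_large_of` from the base
`N₁ ≤ p₀` of regime one (`2(q + 1) ≤ N₁`, the kernel evaluation `hbase` at `N₁`, regime two from `2^{q+2} + 3(q + 1) + 2 ≤ p₀`). -/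
theorem c025_level_succ_of_keyL_row' (q : ℕ) (hq : 7 ≤ q) (p₀ N₁ : ℕ) (hN₁ : N₁ ≤ p₀) (hm : 2 * (q + 1) ≤ N₁)
    (hbase : 8 * (q + 1 + 1) * 2 ^ (2 ^ (q + 1) - 1 - (q + 1)) * N₁ ^ (q + 1) ≤ 2 ^ N₁)
    (hp2 : 2 ^ (q + 1 + 1) + 3 * (q + 1) + 2 ≤ p₀)
    (htail : 2 * (q + 1 + 2 ^ (q + 1)) + 3 * (q + 1) + 5 ≤ p₀)
    (hrow : ∀ t < 2 ^ (q + 1), Explicit.KeyL (q + 1) p₀ (q + 2 + t))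
    (hprev : ∀ (M : Matroid α) [M.Finite] (p : ℕ), p₀ - 1 ≤ p → RLS M p q) :
    ∀ (M : Matroid α) [M.Finite] (p : ℕ), p₀ ≤ p → RLS M p (q + 1) :=
  c025_level_succ_of_key_row' q hq p₀ (Explicit.KeyL (q + 1))
    (fun M _ p hp hR hbig hfree => c025_core_explicit_large_of (q + 1) (by omega) N₁
      (Explicit.regime_one_of_base (q + 1) N₁ hm hbase) M p (hN₁.trans hp) (hp2.trans hp) hR hbig hfree)
    htail (fun p d hd h => Explicit.keyL_succ (q + 1) p d hd h)
    (fun M _ p d hd1 hd2 ht hk hR hn hfree => c025_core_lin2_of_keyL (q + 1) (by omega) M p d hd1 hd2 ht hk hR hn hfree)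
    hrow hprev

end ThmN

end PercRepro
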